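import Literature.NumberTheory.LFunctions.HardyZRiemannSiegelEvaluationSharp
import HarnessLib

/-!
# SigmaL / BC5 rung W0 — fast Riemann–Siegel tables for main sums of length `≈ 7·10⁵`

Route `RiemannHypothesis/HardyZLehmerSplit`, item `SigmaL` (stmt-RiemannHypothesis-24253), tribunal
seat `rh-trib-w-sigmaL-1` (bc5-witness). COMPUTATIONAL SUPPORT ONLY: nothing in this file bears on the
truth of the Riemann Hypothesis or of `SigmaL`.

The certified evaluator `Literature.NumberTheory.LFunctions.RSEval.hardyZBoxS` (soundness
`RSEval.mem_hardyZBoxS`, no named fact) takes `RSEval.RSTables`; the tree's builder `RSEval.mkRSTables`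
computes every `log n` afresh by `≈ 70–100` series terms and every `n^{-1/2}` by a Taylor exponential,
in ONE structural recursion of depth `N`. At height `t ≈ 3·10¹²` the main sum has `N = 691 008` terms,
so this file provides a cheaper builder with the SAME validity predicate `RSEval.RSTables.Valid`:

* `logsRun` / `logsBlocks` / `mkLogsF` — the logarithm table by the recurrence
  `log (n+1) = log n − log (1 − 1/(n+1))` (`MI.logOneSub` with `⌊bits / log₂(n+1)⌋ + 2` series terms,
  at the guard scale `S' = S·2^guard`), in nested loops of depth `≤ 1024`;
* `magAt` / `mkMagsF` — `n^{-1/2}` as `[⌊√(S²/n)⌋, ⌊√(S²/n)⌋ + 1]/S` by `Nat.sqrt`;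
* `mkTablesF`, `mkRSTablesF` and **`mkRSTablesF_valid : mkRSTablesF … = some R → R.Valid`**.

[cite: Gabcke1979, Einleitung (1) p. 2]; interval inclusion property [folklore].
-/

set_option linter.dupNamespace false
set_option autoImplicit false

open Literature.Analysis.ValidatedNumerics.NumericsMP Literature.NumberTheory.LFunctions
open Literature.NumberTheory.LFunctions.ZetaNumerics Literature.NumberTheory.LFunctions.RSEval

namespace Summit.RiemannHypothesis.RiemannHypothesis.Theorems.SigmaLCert

/-! ## 1. The logarithm table by recurrence -/

/-- Inner loop: from `A = [junk, log 1, …, log n]` (scale `S`) and `L ∋ log n` (scale `S'`), push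
`log (n+1), …, log (n+c)` using `log (m+1) = log m − log (1 − 1/(m+1))`. [folklore] -/
def logsRun (S S' bits : ℕ) : Array MI → MI → ℕ → ℕ → Option (Array MI × MI)
  | A, L, _, 0 => some (A, L)
  | A, L, n, c + 1 =>
    match MI.logOneSub S' (bits / Nat.log2 (n + 1) + 2) (MI.ofFrac S' 1 (n + 1)) with
    | some Y =>
      logsRun S S' bits (A.push (MI.rescale S' S (L.sub Y))) (L.sub Y) (n + 1) c
    | none => none

/-- Outer loop: `k` blocks of `blk` steps of `logsRun`. [folklore] -/
def logsBlocks (S S' bits blk : ℕ) : Array MI → MI → ℕ → ℕ → Option (Array MI × MI)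
  | A, L, _, 0 => some (A, L)
  | A, L, n, k + 1 =>
    match logsRun S S' bits A L n blk with
    | some AL => logsBlocks S S' bits blk AL.1 AL.2 AL.1.size.pred k
    | none => none

/-- The table `[junk, log 1, …, log N]` at scale `S` (`N ≥ 1`), guard scale `S'`. [folklore] -/
def mkLogsF (S S' bits N : ℕ) : Option (Array MI) :=
  let blk := 1024
  match logsBlocks S S' bits blk #[default, ⟨0, 0⟩] ⟨0, 0⟩ 1 ((N - 1) / blk) with
  | some AL =>
    match logsRun S S' bits AL.1 AL.2 AL.1.size.pred ((N - 1) % blk) with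
    | some AL' => some AL'.1
    | none => none
  | none => none

/-- `log (1 − 1/(n+1)) = log n − log (n+1)` for `n ≥ 1`. [folklore] -/
private lemma log_one_sub_inv {n : ℕ} (hn : 1 ≤ n) :
    Real.log (1 - (1 : ℝ) / ((n + 1 : ℕ) : ℝ)) = Real.log n - Real.log ((n + 1 : ℕ) : ℝ) := by
  have hn0 : (0 : ℝ) < n := by exact_mod_cast hn
  have h1 : (1 : ℝ) - 1 / ((n + 1 : ℕ) : ℝ) = (n : ℝ) / ((n + 1 : ℕ) : ℝ) := by
    push_cast; field_simp; ring
  rw [h1, Real.log_div hn0.ne' (by positivity)]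

/-- Soundness of `logsRun` (loop invariant: `n ≥ 1`, `A = [junk, log 1, …, log n]` at scale `S`,
`L ∋ log n` at scale `S'`). [folklore] -/
theorem logsRun_spec {S S' bits : ℕ} (hS' : 0 < S') :
    ∀ (c : ℕ) {A : Array MI} {L : MI} {n : ℕ} {AL : Array MI × MI},
      1 ≤ n → A.size = n + 1 → (∀ m : ℕ, 1 ≤ m → m ≤ n → MI.mem S (Real.log m) (A.getD m default)) →
      MI.mem S' (Real.log n) L → logsRun S S' bits A L n c = some AL →
        AL.1.size = n + c + 1 ∧
          (∀ m : ℕ, 1 ≤ m → m ≤ n + c → MI.mem S (Real.log m) (AL.1.getD m default)) ∧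
          MI.mem S' (Real.log ((n + c : ℕ) : ℝ)) AL.2
  | 0, A, L, n, AL, hn, hsz, hmem, hL, h => by
    simp only [logsRun, Option.some.injEq] at h
    subst h
    exact ⟨hsz, hmem, by simpa using hL⟩
  | c + 1, A, L, n, AL, hn, hsz, hmem, hL, h => by
    simp only [logsRun] at h
    split at h
    · rename_i Y hY
      have hx : MI.mem S' ((1 : ℤ) / ((n + 1 : ℕ) : ℝ)) (MI.ofFrac S' 1 (n + 1)) :=
        MI.mem_ofFrac S' 1 (q := n + 1) (by omega)
      have hlog := MI.mem_logOneSub hS' hY hx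
      have hL' : MI.mem S' (Real.log ((n + 1 : ℕ) : ℝ)) (L.sub Y) := by
        have := MI.mem_sub hL hlog
        push_cast at this
        rw [show ((n : ℝ) + 1) = ((n + 1 : ℕ) : ℝ) by push_cast; ring, log_one_sub_inv hn] at this
        convert this using 1; ring
      have hsz' : (A.push (MI.rescale S' S (L.sub Y))).size = n + 1 + 1 := by simp [hsz]
      have hmem' : ∀ m : ℕ, 1 ≤ m → m ≤ n + 1 →
          MI.mem S (Real.log m) ((A.push (MI.rescale S' S (L.sub Y))).getD m default) := by
        intro m h1 h2
        rcases Nat.lt_succ_iff_lt_or_eq.1 (Nat.lt_succ_of_le h2) with hlt | heq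
        · have hm : m ≤ n := Nat.lt_succ_iff.1 hlt
          have hlt' : m < A.size := by rw [hsz]; omega
          have := hmem m h1 hm
          rw [Array.getD_eq_getD_getElem?, Array.getElem?_push_lt hlt', Option.getD_some]
          rw [Array.getD_eq_getD_getElem?, getElem?_pos A m hlt', Option.getD_some] at this
          exact this
        · subst heq
          have hidx : (A.push (MI.rescale S' S (L.sub Y)))[n + 1]? =
              some (MI.rescale S' S (L.sub Y)) := by
            rw [← hsz]; exact Array.getElem?_push_size
          rw [Array.getD_eq_getD_getElem?, hidx, Option.getD_some]
          exact MI.mem_rescale hS' S hL'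
      have := logsRun_spec hS' c (by omega) hsz' hmem' hL' h
      rw [show n + 1 + c = n + (c + 1) by omega] at this
      exact this
    · simp at h

/-- Soundness of `logsBlocks` (same invariant as `logsRun_spec`). [folklore] -/
theorem logsBlocks_spec {S S' bits blk : ℕ} (hS' : 0 < S') :
    ∀ (k : ℕ) {A : Array MI} {L : MI} {n : ℕ} {AL : Array MI × MI},
      1 ≤ n → A.size = n + 1 → (∀ m : ℕ, 1 ≤ m → m ≤ n → MI.mem S (Real.log m) (A.getD m default)) →
      MI.mem S' (Real.log n) L → logsBlocks S S' bits blk A L n k = some AL →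
        AL.1.size = n + blk * k + 1 ∧
          (∀ m : ℕ, 1 ≤ m → m ≤ n + blk * k → MI.mem S (Real.log m) (AL.1.getD m default)) ∧
          MI.mem S' (Real.log ((n + blk * k : ℕ) : ℝ)) AL.2
  | 0, A, L, n, AL, hn, hsz, hmem, hL, h => by
    simp only [logsBlocks, Option.some.injEq] at h
    subst h
    exact ⟨by simpa using hsz, by simpa using hmem, by simpa using hL⟩
  | k + 1, A, L, n, AL, hn, hsz, hmem, hL, h => by
    simp only [logsBlocks] at h
    split at h
    · rename_i AL₁ h₁
      obtain ⟨hsz₁, hmem₁, hL₁⟩ := logsRun_spec hS' blk hn hsz hmem hL h₁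
      have hsz' : AL₁.1.size.pred = n + blk := by rw [hsz₁]; rfl
      rw [hsz'] at h
      have := logsBlocks_spec hS' k (by omega) hsz₁ hmem₁ hL₁ h
      rw [show n + blk + blk * k = n + blk * (k + 1) by ring] at this
      exact this
    · simp at h

/-- Soundness of `mkLogsF`: size `N + 1` and `log m ∈ logs[m]` for `1 ≤ m ≤ N` (`N ≥ 1`).
[folklore] -/
theorem mkLogsF_spec {S S' bits N : ℕ} (hS' : 0 < S') (hN : 1 ≤ N) {A : Array MI}
    (h : mkLogsF S S' bits N = some A) :
    A.size = N + 1 ∧ ∀ m : ℕ, 1 ≤ m → m ≤ N → MI.mem S (Real.log m) (A.getD m default) := by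
  have hmem0 : ∀ m : ℕ, 1 ≤ m → m ≤ 1 →
      MI.mem S (Real.log m) ((#[default, ⟨0, 0⟩] : Array MI).getD m default) := by
    intro m h1 h2
    obtain rfl : m = 1 := le_antisymm h2 h1
    simp [MI.mem]
  have hL0 : MI.mem S' (Real.log ((1 : ℕ) : ℝ)) ⟨0, 0⟩ := by simp [MI.mem]
  unfold mkLogsF at h
  simp only at h
  split at h
  · rename_i AL hAL
    split at h
    · rename_i AL' hAL'
      simp only [Option.some.injEq] at h
      subst h
      obtain ⟨hsz, hmem, hL⟩ := logsBlocks_spec hS' _ le_rfl rfl hmem0 hL0 hAL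
      have hsz' : AL.1.size.pred = 1 + 1024 * ((N - 1) / 1024) := by rw [hsz]; rfl
      rw [hsz'] at hAL'
      obtain ⟨hsz2, hmem2, -⟩ := logsRun_spec hS' _ (by omega) hsz hmem hL hAL'
      have hNeq : 1 + 1024 * ((N - 1) / 1024) + (N - 1) % 1024 = N := by
        have := Nat.div_add_mod (N - 1) 1024; omega
      rw [hNeq] at hsz2 hmem2
      exact ⟨hsz2, hmem2⟩
    · simp at h
  · simp at h

/-! ## 2. The magnitude table by integer square roots -/

/-- `[⌊√(S²/m)⌋, ⌊√(S²/m)⌋ + 1] ∋ S · m^{-1/2}`. [folklore] -/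
def magAt (S m : ℕ) : MI :=
  let s := Nat.sqrt (S * S / m)
  ⟨(s : ℤ), (s : ℤ) + 1⟩

/-- Soundness of `magAt`: `e^{−(log m)/2} = m^{-1/2} ∈ magAt S m` (`m ≥ 1`). [folklore] -/
theorem mem_magAt (S : ℕ) {m : ℕ} (hm : 1 ≤ m) :
    MI.mem S (Real.exp (-(Real.log m / 2))) (magAt S m) := by
  have hm0 : (0 : ℝ) < m := by exact_mod_cast hm
  have hmN : 0 < m := hm
  set q : ℕ := S * S / m with hq
  set s : ℕ := Nat.sqrt q with hs
  -- natural-number facts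
  have h1 : s * s * m ≤ S * S := (Nat.mul_le_mul_right m (Nat.sqrt_le q)).trans (Nat.div_mul_le_self _ _)
  have h2 : S * S < (s + 1) * (s + 1) * m := by
    have hq1 : q + 1 ≤ (s + 1) * (s + 1) := Nat.succ_le_of_lt (Nat.lt_succ_sqrt q)
    have hlt : S * S < (q + 1) * m := by
      have := Nat.lt_div_mul_add (a := S * S) hmN
      rw [hq]; linarith [Nat.add_mul (S * S / m) 1 m]
    exact hlt.trans_le (Nat.mul_le_mul_right m hq1)
  -- the value is S/√m
  have hval : Real.exp (-(Real.log m / 2)) = (Real.sqrt m)⁻¹ := by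
    rw [Real.exp_neg, Real.sqrt_eq_rpow, Real.rpow_def_of_pos hm0]
    congr 1; congr 1; ring
  have hsq : 0 < Real.sqrt m := Real.sqrt_pos.2 hm0
  have hsqm : Real.sqrt m * Real.sqrt m = m := Real.mul_self_sqrt hm0.le
  unfold MI.mem magAt
  simp only
  rw [hval]
  have h1r : ((s : ℝ) * s) * m ≤ (S : ℝ) * S := by exact_mod_cast h1
  have h2r : (S : ℝ) * S < (((s : ℝ) + 1) * (s + 1)) * m := by exact_mod_cast h2
  constructor
  · -- s ≤ S/√m  ⟸  (s √m)² ≤ S²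
    push_cast
    rw [show ((Real.sqrt m)⁻¹ * S : ℝ) = S / Real.sqrt m by ring, le_div_iff₀ hsq]
    have hs0 : (0 : ℝ) ≤ s * Real.sqrt m := by positivity
    nlinarith [hsqm, h1r, sq_nonneg ((s : ℝ) * Real.sqrt m - S)]
  · push_cast
    rw [show ((Real.sqrt m)⁻¹ * S : ℝ) = S / Real.sqrt m by ring, div_le_iff₀ hsq]
    have hs0 : (0 : ℝ) ≤ ((s : ℝ) + 1) * Real.sqrt m := by positivity
    nlinarith [hsqm, h2r, sq_nonneg (((s : ℝ) + 1) * Real.sqrt m - S)]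

/-- Inner loop: push `magAt S (n+1), …, magAt S (n+c)`. [folklore] -/
def magsRun (S : ℕ) : Array MI → ℕ → ℕ → Array MI
  | A, _, 0 => A
  | A, n, c + 1 => magsRun S (A.push (magAt S (n + 1))) (n + 1) c

/-- Outer loop: `k` blocks of `blk` steps of `magsRun`. [folklore] -/
def magsBlocks (S blk : ℕ) : Array MI → ℕ → ℕ → Array MI
  | A, _, 0 => A
  | A, n, k + 1 => magsBlocks S blk (magsRun S A n blk) (n + blk) k

/-- The table `[junk, 1^{-1/2}, …, N^{-1/2}]` at scale `S`. [folklore] -/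
def mkMagsF (S N : ℕ) : Array MI :=
  magsRun S (magsBlocks S 1024 #[default] 0 (N / 1024)) (1024 * (N / 1024)) (N % 1024)

/-- Soundness of `magsRun` (invariant: `A = [junk, 1^{-1/2}, …, n^{-1/2}]`). [folklore] -/
theorem magsRun_spec (S : ℕ) : ∀ (c : ℕ) {A : Array MI} {n : ℕ},
    (A.size = n + 1 ∧ ∀ m : ℕ, 1 ≤ m → m ≤ n →
      MI.mem S (Real.exp (-(Real.log m / 2))) (A.getD m default)) →
    ((magsRun S A n c).size = n + c + 1 ∧ ∀ m : ℕ, 1 ≤ m → m ≤ n + c →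
      MI.mem S (Real.exp (-(Real.log m / 2))) ((magsRun S A n c).getD m default))
  | 0, A, n, hI => by simpa [magsRun] using hI
  | c + 1, A, n, hI => by
    simp only [magsRun]
    have hI' : (A.push (magAt S (n + 1))).size = n + 1 + 1 ∧ ∀ m : ℕ, 1 ≤ m → m ≤ n + 1 →
        MI.mem S (Real.exp (-(Real.log m / 2))) ((A.push (magAt S (n + 1))).getD m default) := by
      refine ⟨by simp [hI.1], fun m h1 h2 ↦ ?_⟩
      rcases Nat.lt_succ_iff_lt_or_eq.1 (Nat.lt_succ_of_le h2) with hlt | heq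
      · have hm : m ≤ n := Nat.lt_succ_iff.1 hlt
        have hlt' : m < A.size := by rw [hI.1]; omega
        have := hI.2 m h1 hm
        rw [Array.getD_eq_getD_getElem?, Array.getElem?_push_lt hlt', Option.getD_some]
        rw [Array.getD_eq_getD_getElem?, getElem?_pos A m hlt', Option.getD_some] at this
        exact this
      · subst heq
        have hidx : (A.push (magAt S (n + 1)))[n + 1]? = some (magAt S (n + 1)) := by
          rw [← hI.1]; exact Array.getElem?_push_size
        rw [Array.getD_eq_getD_getElem?, hidx, Option.getD_some]
        exact mem_magAt S (by omega)
    have := magsRun_spec S c hI'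
    rw [show n + 1 + c = n + (c + 1) by omega] at this
    exact this

/-- Soundness of `magsBlocks`. [folklore] -/
theorem magsBlocks_spec (S blk : ℕ) : ∀ (k : ℕ) {A : Array MI} {n : ℕ},
    (A.size = n + 1 ∧ ∀ m : ℕ, 1 ≤ m → m ≤ n →
      MI.mem S (Real.exp (-(Real.log m / 2))) (A.getD m default)) →
    ((magsBlocks S blk A n k).size = n + blk * k + 1 ∧ ∀ m : ℕ, 1 ≤ m → m ≤ n + blk * k →
      MI.mem S (Real.exp (-(Real.log m / 2))) ((magsBlocks S blk A n k).getD m default))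
  | 0, A, n, hI => by simpa [magsBlocks] using hI
  | k + 1, A, n, hI => by
    simp only [magsBlocks]
    have := magsBlocks_spec S blk k (magsRun_spec S blk hI)
    rw [show n + blk + blk * k = n + blk * (k + 1) by ring] at this
    exact this

/-- Soundness of `mkMagsF`: size `N + 1` and `m^{-1/2} ∈ mags[m]` for `1 ≤ m ≤ N`. [folklore] -/
theorem mkMagsF_spec (S N : ℕ) : (mkMagsF S N).size = N + 1 ∧ ∀ m : ℕ, 1 ≤ m → m ≤ N →
    MI.mem S (Real.exp (-(Real.log m / 2))) ((mkMagsF S N).getD m default) := by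
  have hI0 : (#[default] : Array MI).size = 0 + 1 ∧ ∀ m : ℕ, 1 ≤ m → m ≤ 0 →
      MI.mem S (Real.exp (-(Real.log m / 2))) ((#[default] : Array MI).getD m default) :=
    ⟨rfl, fun m h1 h2 ↦ by omega⟩
  have := magsRun_spec S (N % 1024) (magsBlocks_spec S 1024 (N / 1024) hI0)
  rw [show 0 + 1024 * (N / 1024) + N % 1024 = N from by have := Nat.div_add_mod N 1024; omega,
    Nat.zero_add] at this
  unfold mkMagsF
  exact this

/-! ## 3. Tables -/

/-- `ZetaNumerics.Tables` at scale `S` for main sums of length `≤ N` (`ν = 1`): `π` by Machin with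
`Kpi` terms and the logarithms by `mkLogsF`, both at the guard scale `S·2^guard`. [folklore] -/
def mkTablesF (S N guard bits Kpi Kexp kexp KI kI : ℕ) : Option Tables :=
  let S' := S * 2 ^ guard
  if 0 < S ∧ 2 ≤ N then
    match MI.pi S' Kpi, mkLogsF S S' bits N, emRatios 1 with
    | some P, some A, some R => some ⟨S, N, 1, MI.rescale S' S P, A, R, Kexp, kexp, KI, kI⟩
    | _, _, _ => none
  else none

/-- Tables built by `mkTablesF` are valid, with the given `S` and `N`. [folklore] -/
theorem mkTablesF_valid {S N guard bits Kpi Kexp kexp KI kI : ℕ} {T : Tables}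
    (h : mkTablesF S N guard bits Kpi Kexp kexp KI kI = some T) : T.Valid ∧ T.S = S ∧ T.N = N := by
  unfold mkTablesF at h
  simp only at h
  split_ifs at h with hc
  split at h
  · rename_i P A R hP hA hR
    simp only [Option.some.injEq] at h
    subst h
    obtain ⟨hS, hN⟩ := hc
    have hS' : 0 < S * 2 ^ guard := Nat.mul_pos hS (pow_pos (by norm_num) _)
    obtain ⟨hsz, hmem⟩ := mkLogsF_spec (S := S) (bits := bits) hS' (by omega) hA
    exact ⟨⟨hS, hN, by norm_num, MI.mem_rescale hS' S (MI.mem_pi _ hP), hsz, hmem, hR⟩, rfl, rfl⟩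
  · simp at h

/-- `RSEval.RSTables` at scale `S` for main sums of length `≤ N`: `mkTablesF`, `mkMagsF`, and
`log 2`, `log π = log 3 − log(1 − (1 − 3/π))`, `2K(¼)` as in `RSEval.mkRSTables` (`KlogT` series terms).
[cite: Gabcke1979, Einleitung (1) p. 2] -/
def mkRSTablesF (S N guard bits Kpi Kexp kexp KI kI KlogT : ℕ) : Option RSTables :=
  match mkTablesF S N guard bits Kpi Kexp kexp KI kI with
  | none => none
  | some T =>
    match MI.logTwo S KlogT, logNatK S KlogT 3, MI.divPos S (MI.ofInt S 3) T.piI with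
    | some l2, some l3, some q =>
      match MI.logOneSub S KlogT ((MI.ofInt S 1).sub q) with
      | some lq =>
        some ⟨T, mkMagsF S N, l2, l3.sub lq,
          (((MI.ofFrac S 1 6).add (MI.ofFrac S 5 32)).add (T.piI.divNat 12)).mulInt 2, KlogT⟩
      | none => none
    | _, _, _ => none

/-- **Tables built by `mkRSTablesF` are valid** (same predicate `RSEval.RSTables.Valid` as the
tree's `mkRSTables_valid`, so `RSEval.mem_hardyZBoxS` applies verbatim).
[cite: Gabcke1979, Einleitung (1) p. 2] -/
theorem mkRSTablesF_valid {S N guard bits Kpi Kexp kexp KI kI KlogT : ℕ} {R : RSTables}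
    (h : mkRSTablesF S N guard bits Kpi Kexp kexp KI kI KlogT = some R) : R.Valid := by
  unfold mkRSTablesF at h
  split at h
  · simp at h
  · rename_i T hT
    obtain ⟨hTv, hTS, hTN⟩ := mkTablesF_valid hT
    have hS : 0 < S := hTS ▸ hTv.S_pos
    split at h
    · rename_i l2 l3 q hl2 hl3 hq
      split at h
      · rename_i lq hlq
        simp only [Option.some.injEq] at h
        subst h
        have hpi : MI.mem S Real.pi T.piI := hTS ▸ hTv.mem_pi
        obtain ⟨hsz, hmem⟩ := mkMagsF_spec S N
        rw [logNatK_eq] at hl3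
        have hlog3 := MI.mem_logNat hS hl3
        have h3pi : MI.mem S ((3 : ℝ) / Real.pi) q := by
          have := MI.mem_divPos hS hq (MI.mem_ofInt S 3) hpi; simpa using this
        have hx : MI.mem S (1 - 3 / Real.pi) ((MI.ofInt S 1).sub q) := by
          have := MI.mem_sub (MI.mem_ofInt S 1) h3pi; simpa using this
        have hlq' := MI.mem_logOneSub hS hlq hx
        have elq : Real.log (1 - (1 - 3 / Real.pi)) = Real.log 3 - Real.log Real.pi := by
          rw [show (1 : ℝ) - (1 - 3 / Real.pi) = 3 / Real.pi by ring,
            Real.log_div (by norm_num) Real.pi_pos.ne']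
        rw [elq] at hlq'
        have hlpi : MI.mem S (Real.log Real.pi) (l3.sub lq) := by
          have := MI.mem_sub hlog3 hlq'
          convert this using 1; push_cast; ring
        have hK : MI.mem S (2 * stirlingVertRate (1 / 4))
            ((((MI.ofFrac S 1 6).add (MI.ofFrac S 5 32)).add (T.piI.divNat 12)).mulInt 2) := by
          have := MI.mem_mulInt (MI.mem_add (MI.mem_add (MI.mem_ofFrac S 1 (q := 6) (by norm_num))
            (MI.mem_ofFrac S 5 (q := 32) (by norm_num))) (MI.mem_divNat hpi (n := 12) (by norm_num))) 2
          convert this using 1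
          unfold stirlingVertRate; push_cast; ring
        refine ⟨hTv, by rw [hsz, hTN], fun n h1 h2 ↦ ?_, hTS ▸ MI.mem_logTwo hS hl2, hTS ▸ hlpi,
          hTS ▸ hK⟩
        exact hTS ▸ hmem n h1 (by rw [← hTN]; exact h2)
      · simp at h
    · simp at h

end Summit.RiemannHypothesis.RiemannHypothesis.Theorems.SigmaLCert
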